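import Literature.MathematicalPhysics.QuantumFieldTheory.Balaban1983to89.B12RegularSpaces111

/-!
# `Balaban1983to89.B12RegularSpaces111Mono` — T. Bałaban, *Renormalization group approach to lattice gauge field
theories. I*, Commun. Math. Phys. **109** (1987) 249–301 [Balaban1987RG1]: the complex regular spaces `U^c_j(X, α₀, α₁, γ₀)`
of pp. 262–263 (sibling `B12RegularSpaces111`) — the printed monotonicity in the radii PROVED for each of the conditions
(i)–(iv) and for the space, hence the abstract carrier `Setup.CplxRegularSpace` INSTANTIATED by the concrete spaces; (3.16)
monotone in `β`; the unit configuration as a non-vacuity witness of (i)–(iii) and, given unit (iv)-data, of the space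

HONEST FRAMING (cell `lit-balaban`, verbatim): statement-level skeleton of published theorems with citation tags; proofs where landed; nothing here is a claim about the Yang–Mills mass gap.

PDF held: `paper:balaban1987-cmp109-rg-i-small-field` (journal page = PDF page + 248); read from the page renders
`b2b-balaban-ref1/pages/1987-cmp109-rg-I-small-field/…-p014-x2.png` (p. 262), `…-p015-x2.png` (p. 263), `…-p025-x2.png` (p. 273).

WHAT IS REPRODUCED.  The provable members of SKELETON rows `B12.Eq1.11-1.14`, `B12.Eq1.15-1.16`, `B12.Eq3.15-3.16` over the
CONCRETE predicates of `B12RegularSpaces111` (`CondI` … `CondIV`, `SatisfiesI_III`, `Satisfies`, `space`, `space316`).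
THE PRINT, verbatim (p. 263, the paragraph of (1.17)): *«Let us take the space of configurations (𝐔, 𝐉) satisfying the conditions
(i)–(iii) with constants α₀′, α₁′ instead of α₀, α₁. We assume that the constants α₀′, α₁′ are smaller than α₀, α₁
correspondingly, then obviously these three conditions are satisfied in the original formulation.»*; the abstract carrier
`Setup.CplxRegularSpace` (its docstring): *«a family of sets of (complex) configurations indexed by the domain X and the three radii,
monotone in the radii»*; p. 273 (3.16): *«U^c_j(X, ½α₀, ½α₁, α₀) ∩ {(𝐔, 𝐉): 𝐔, 𝐉 satisfy the conditions (i)–(iii) for j = k+1, and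
with the constants (1+β)α₀, (1+β)α₁, α₀}»* (used on p. 277 (3.36) / p. 280 (3.53) with `(1+2β)` in place of `(1+β)`).
PROVED: `condI_mono` … `condIV_mono`, `satisfiesI_III_mono`, `satisfies_mono`, `space_mono` (each strict printed bound is monotone in
its radius; for (1.12) under `0 ≤ O(1)LMB`), `cplxRegularSpace` (+ `cplxRegularSpace_mem`: the `Setup.CplxRegularSpace` whose
`mem X α₀ α₁ γ₀` IS the concrete `space`, its `mono` field = `space_mono`), `satisfiesI_III_of_mem_space316`, `space316_mono`, and the
non-vacuity witnesses `satisfiesI_III_one` (the unit pair `(𝐔, 𝐉) = (1, 0)` satisfies (i)–(iii) for positive radii — `U = 1`,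
`A′ = 0` in the factorisation, `u = 1`, `A = 0` in (1.12)) and `one_mem_space` (it lies in `U^c_j(X, α₀, α₁, γ₀)` as soon as the
(iv)-DATA send the unit configuration to unit / zero configurations).  NOT here: Proposition 9 [15] / (1.17) (`B12Eq117Membership`).
No `Prop` placeholder, no new fact; axioms standard.  Unit `lit-balaban-p07` (Phase-2 seat p07 gen 2), HOME `run/shared/lean/pub/lit-balaban/`.
-/

namespace Literature.MathematicalPhysics.QuantumFieldTheory.Balaban1983to89.B12RegularSpaces111Mono

open Literature.MathematicalPhysics.QuantumFieldTheory.Balaban1983to89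
open Literature.MathematicalPhysics.QuantumFieldTheory.Balaban1983to89.B12RegularSpaces111
open Complex

noncomputable section

variable {P : Params} {i : ℕ} {𝔸 : Type*} [NormedRing 𝔸] [NormedAlgebra ℂ 𝔸] [CompleteSpace 𝔸]
variable {𝓜 : Model 𝔸}

/-! ## §1. Monotonicity in the radii (p. 263) and the `Setup.CplxRegularSpace` structure -/

/-- (i) with `α₀` implies (i) with `α₀′ ≥ α₀` (for `O(1)LMB ≥ 0`). [cite: Balaban1987RG1, (1.11)-(1.12) p.262] -/
theorem condI_mono {F : Frame P i 𝔸} {c : StepConsts} (hc : 0 ≤ c.cB) {α₀ α₀' : ℝ} (hα : α₀ ≤ α₀')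
    {U : PBond P i → 𝔸ˣ} (h : CondI 𝓜 F c α₀ U) : CondI 𝓜 F c α₀' U := by
  have hξ : α₀ * c.ξ ^ 2 ≤ α₀' * c.ξ ^ 2 := mul_le_mul_of_nonneg_right hα (sq_nonneg _)
  have hB : c.cB * α₀ ≤ c.cB * α₀' := mul_le_mul_of_nonneg_left hα hc
  refine ⟨h.gValued, fun p hp => (h.plaq_lt p hp).trans_le hξ, fun C hC => ?_⟩
  obtain ⟨u, hu, A, hgauge, hA, hdA⟩ := h.localGauge C hC
  exact ⟨u, hu, A, hgauge, fun b hb => (hA b hb).trans_le hB, fun q hq => (hdA q hq).trans_le hB⟩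

omit [CompleteSpace 𝔸] in
/-- (ii) with `α₁` implies (ii) with `α₁′ ≥ α₁`. [cite: Balaban1987RG1, (1.13) p.262] -/
theorem condII_mono {X : Region P i} {c : StepConsts} {α₁ α₁' : ℝ} (hα : α₁ ≤ α₁') {U : PBond P i → 𝔸ˣ}
    {A' : PBond P i → 𝔸} (h : CondII 𝓜 X c α₁ U A') : CondII 𝓜 X c α₁' U A' :=
  ⟨h.gcValued, fun b hb => (h.norm_lt b hb).trans_le hα, fun q hq => (h.nabla_lt q hq).trans_le hα⟩

omit [NormedAlgebra ℂ 𝔸] [CompleteSpace 𝔸] in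
/-- (iii) with `α₀, γ₀` implies (iii) with `α₀′ ≥ α₀, γ₀′ ≥ γ₀`. [cite: Balaban1987RG1, (1.14) p.262] -/
theorem condIII_mono {X : Region P i} {c : StepConsts} {α₀ α₀' γ₀ γ₀' : ℝ} (hα : α₀ ≤ α₀') (hγ : γ₀ ≤ γ₀')
    {Uc : PBond P i → 𝔸ˣ} {Jc : PBond P i → 𝔸} (h : CondIII X c α₀ γ₀ Uc Jc) : CondIII X c α₀' γ₀' Uc Jc :=
  ⟨fun p hp => (h.plaq_lt p hp).trans_le (mul_le_mul_of_nonneg_right hα (sq_nonneg _)),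
    fun b hb => (h.J_lt b hb).trans_le hγ⟩

omit [NormedAlgebra ℂ 𝔸] [CompleteSpace 𝔸] in
/-- (iv) with `α₀` implies (iv) with `α₀′ ≥ α₀`. [cite: Balaban1987RG1, (1.15)-(1.16) p.262] -/
theorem condIV_mono {bg : BackgroundFns P i 𝔸} {X₂ : Region P i} {c : StepConsts} {α₀ α₀' : ℝ} (hα : α₀ ≤ α₀')
    {V : PBond P i → 𝔸ˣ} (h : CondIV bg X₂ c α₀ V) : CondIV bg X₂ c α₀' V :=
  ⟨fun n hn hnj p hp => (h.plaq_lt n hn hnj p hp).trans_le (mul_le_mul_of_nonneg_right hα (sq_nonneg _)),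
    fun n hn hnj b hb => (h.J_lt n hn hnj b hb).trans_le (mul_le_mul_of_nonneg_right hα (sq_nonneg _))⟩

/-- «We assume that the constants α₀′, α₁′ are smaller than α₀, α₁ correspondingly, then obviously these three conditions are
satisfied in the original formulation» — (i)–(iii) are monotone in `(α₀, α₁, γ₀)` (for `O(1)LMB ≥ 0`).
[cite: Balaban1987RG1, (1.17) p.263] -/
theorem satisfiesI_III_mono {F : Frame P i 𝔸} {c : StepConsts} (hc : 0 ≤ c.cB) {α₀ α₀' α₁ α₁' γ₀ γ₀' : ℝ}
    (hα₀ : α₀ ≤ α₀') (hα₁ : α₁ ≤ α₁') (hγ : γ₀ ≤ γ₀') {Φ : FieldPair P i 𝔸ˣ 𝔸}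
    (h : SatisfiesI_III 𝓜 F c α₀ α₁ γ₀ Φ) : SatisfiesI_III 𝓜 F c α₀' α₁' γ₀' Φ := by
  obtain ⟨hG, hg, U, A', hf, h1, h2, h3⟩ := h
  exact ⟨hG, hg, U, A', hf, condI_mono hc hα₀ h1, condII_mono hα₁ h2, condIII_mono hα₀ hγ h3⟩

/-- (i)–(iv) are monotone in `(α₀, α₁, γ₀)` (for `O(1)LMB ≥ 0`). [cite: Balaban1987RG1, (1.17) p.263] -/
theorem satisfies_mono {F : Frame P i 𝔸} {c : StepConsts} (hc : 0 ≤ c.cB) {α₀ α₀' α₁ α₁' γ₀ γ₀' : ℝ}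
    (hα₀ : α₀ ≤ α₀') (hα₁ : α₁ ≤ α₁') (hγ : γ₀ ≤ γ₀') {Φ : FieldPair P i 𝔸ˣ 𝔸}
    (h : Satisfies 𝓜 F c α₀ α₁ γ₀ Φ) : Satisfies 𝓜 F c α₀' α₁' γ₀' Φ := by
  obtain ⟨hG, hg, U, A', hf, h1, h2, h3, h4, h5⟩ := h
  exact ⟨hG, hg, U, A', hf, condI_mono hc hα₀ h1, condII_mono hα₁ h2, condIII_mono hα₀ hγ h3,
    condIV_mono hα₀ h4, condIV_mono hα₀ h5⟩

/-- **The spaces are monotone in the radii**: `U^c_j(X, α₀, α₁, γ₀) ⊆ U^c_j(X, α₀′, α₁′, γ₀′)` for `α₀ ≤ α₀′`, `α₁ ≤ α₁′`,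
`γ₀ ≤ γ₀′` (and `O(1)LMB ≥ 0`) — the property the abstract carrier `Setup.CplxRegularSpace` postulates as its field `mono`.
[cite: Balaban1987RG1, (1.17) p.263] -/
theorem space_mono {F : Frame P i 𝔸} {c : StepConsts} (hc : 0 ≤ c.cB) {α₀ α₀' α₁ α₁' γ₀ γ₀' : ℝ}
    (hα₀ : α₀ ≤ α₀') (hα₁ : α₁ ≤ α₁') (hγ : γ₀ ≤ γ₀') :
    space 𝓜 F c α₀ α₁ γ₀ ⊆ space 𝓜 F c α₀' α₁' γ₀' := by
  rintro Φ ⟨u, Φ₀, hu, h₀, rfl⟩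
  exact ⟨u, Φ₀, hu, satisfies_mono hc hα₀ hα₁ hγ h₀, rfl⟩

variable (𝓜) in
/-- **The concrete spaces form a `Setup.CplxRegularSpace`** (the abstract carrier of the tree: a family of sets indexed by the
domain and the three radii, monotone in the radii — its `mono` field is `space_mono`), for any assignment of frames to the
domains `X ∈ 𝐃_j` and `O(1)LMB ≥ 0`. [cite: Balaban1987RG1, (1.11)-(1.16) p.262] -/
def cplxRegularSpace {Dom : Type*} (F : Dom → Frame P i 𝔸) (c : StepConsts) (hc : 0 ≤ c.cB) :
    CplxRegularSpace Dom (FieldPair P i 𝔸ˣ 𝔸) where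
  mem X α₀ α₁ γ₀ := space 𝓜 (F X) c α₀ α₁ γ₀
  mono X _ _ _ _ _ _ hα₀ hα₁ hγ := space_mono (F := F X) hc hα₀ hα₁ hγ

/-- The `mem` field of the instantiated carrier is the concrete space. [cite: Balaban1987RG1, (1.11)-(1.16) p.262] -/
theorem cplxRegularSpace_mem {Dom : Type*} (F : Dom → Frame P i 𝔸) (c : StepConsts) (hc : 0 ≤ c.cB) (X : Dom)
    (α₀ α₁ γ₀ : ℝ) : (cplxRegularSpace 𝓜 F c hc).mem X α₀ α₁ γ₀ = space 𝓜 (F X) c α₀ α₁ γ₀ := rfl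

/-! ## §2. (3.16): members and monotonicity in `β` -/

/-- (3.16) grows with `β` (for `α₀, α₁ ≥ 0` and `O(1)LMB ≥ 0`): the spaces of Lemma 4 / (3.36) with `(1+2β)` contain those with
`(1+β)`. [cite: Balaban1987RG1, (3.16) p.273] -/
theorem space316_mono (Fj : Frame P i 𝔸) (cj : StepConsts) (Fk : Frame P i 𝔸) {ck : StepConsts} (hc : 0 ≤ ck.cB)
    {β β' α₀ α₁ : ℝ} (hβ : β ≤ β') (hα₀ : 0 ≤ α₀) (hα₁ : 0 ≤ α₁) :
    space316 𝓜 Fj cj Fk ck β α₀ α₁ ⊆ space316 𝓜 Fj cj Fk ck β' α₀ α₁ := by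
  rintro Φ ⟨h₁, h₂⟩
  have h₂' : SatisfiesI_III 𝓜 Fk ck ((1 + β) * α₀) ((1 + β) * α₁) α₀ Φ := h₂
  have hβ₀ : (1 + β) * α₀ ≤ (1 + β') * α₀ := mul_le_mul_of_nonneg_right (by linarith) hα₀
  have hβ₁ : (1 + β) * α₁ ≤ (1 + β') * α₁ := mul_le_mul_of_nonneg_right (by linarith) hα₁
  exact ⟨h₁, satisfiesI_III_mono hc hβ₀ hβ₁ le_rfl h₂'⟩

/-- The members of (3.16) satisfy (i)–(iii) at scale `k+1` with the constants `(1+β)α₀, (1+β)α₁, α₀`.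
[cite: Balaban1987RG1, (3.16) p.273] -/
theorem satisfiesI_III_of_mem_space316 {Fj : Frame P i 𝔸} {cj : StepConsts} {Fk : Frame P i 𝔸} {ck : StepConsts}
    {β α₀ α₁ : ℝ} {Φ : FieldPair P i 𝔸ˣ 𝔸} (h : Φ ∈ space316 𝓜 Fj cj Fk ck β α₀ α₁) :
    SatisfiesI_III 𝓜 Fk ck ((1 + β) * α₀) ((1 + β) * α₁) α₀ Φ :=
  h.2

/-! ## §3. Non-vacuity: the unit configuration -/

/-- `exp(iξ·0) = 1`. [cite: Balaban1987RG1, (1.13) p.262] -/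
theorem expI_zero (ξ : ℝ) : expI ξ (0 : 𝔸) = 1 := by
  ext
  simp [expI, Beta.BackgroundVertices.val_expUnit]

omit [NormedAlgebra ℂ 𝔸] [CompleteSpace 𝔸] in
/-- The unit configuration has unit plaquette variables. [cite: Balaban1987RG1, (1.11) p.262] -/
theorem plaq_one (p : Plaq P i) : plaq (1 : PBond P i → 𝔸ˣ) p = 1 := by
  simp [plaq_eq]

omit [NormedAlgebra ℂ 𝔸] [CompleteSpace 𝔸] in
/-- `‖∂1(p) − 1‖ = 0 < α₀ξ²` for `α₀ > 0`, `ξ ≠ 0`. [cite: Balaban1987RG1, (1.11) p.262] -/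
private theorem plaq_one_lt (p : Plaq P i) {α₀ ξ : ℝ} (h₀ : 0 < α₀) (hξ : ξ ≠ 0) :
    ‖(↑(plaq (1 : PBond P i → 𝔸ˣ) p) : 𝔸) - 1‖ < α₀ * ξ ^ 2 := by
  rw [plaq_one, Units.val_one, sub_self, norm_zero]
  exact mul_pos h₀ (by positivity)

/-- The unit pair `(𝐔, 𝐉) = (1, 0)`. [cite: Balaban1987RG1, (1.10) p.262] -/
def unitPair : FieldPair P i 𝔸ˣ 𝔸 := ⟨fun _ => 1, fun _ => 0⟩

/-- The trivial factorisation `1 = (exp iξ·0)·1`. [cite: Balaban1987RG1, (1.11) p.262] -/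
theorem factors_one (c : StepConsts) : Factors c (1 : PBond P i → 𝔸ˣ) 1 (fun _ => 0) := fun b => by
  rw [expI_zero, one_mul]

/-- Condition (i) for `U = 1` (positive `α₀`, `O(1)LMB > 0`, `ξ ≠ 0`): `1 ∈ G`, `∂1 = 1`, and on every cube the local gauge `u = 1`
with `1^1 = 1 = exp iξ·0`, `A = 0`. [cite: Balaban1987RG1, (1.11)-(1.12) p.262] -/
theorem condI_one (F : Frame P i 𝔸) {c : StepConsts} (hξ : c.ξ ≠ 0) (hc : 0 < c.cB) {α₀ : ℝ} (h₀ : 0 < α₀) :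
    CondI 𝓜 F c α₀ (1 : PBond P i → 𝔸ˣ) := by
  have hB : 0 < c.cB * α₀ := mul_pos hc h₀
  refine ⟨fun _ _ => 𝓜.G.one_mem, fun p _ => plaq_one_lt p h₀ hξ,
    fun C _ => ⟨1, fun _ => 𝓜.G.one_mem, fun _ => 0, fun b _ => ?_, fun b _ => ?_, fun q _ => ?_⟩⟩
  · rw [expI_zero]
    show (1 : Site P i → 𝔸ˣ) b.src * (1 : PBond P i → 𝔸ˣ) b * ((1 : Site P i → 𝔸ˣ) b.tgt)⁻¹ = 1
    simp
  · simpa using hB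
  · simp only [grad, sub_self, smul_zero, norm_zero]
    exact hB

omit [CompleteSpace 𝔸] in
/-- Condition (ii) for `A′ = 0` (positive `α₁`; any background). [cite: Balaban1987RG1, (1.13) p.262] -/
theorem condII_zero (X : Region P i) (c : StepConsts) {α₁ : ℝ} (h₁ : 0 < α₁) (U : PBond P i → 𝔸ˣ) :
    CondII 𝓜 X c α₁ U (fun _ => 0) := by
  refine ⟨fun _ _ => 𝓜.gc.zero_mem, fun b _ => by simpa using h₁, fun q _ => ?_⟩
  simp only [nabla, mul_zero, zero_mul, sub_self, smul_zero, norm_zero]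
  exact h₁

omit [NormedAlgebra ℂ 𝔸] [CompleteSpace 𝔸] in
/-- Condition (iii) for `(𝐔, 𝐉) = (1, 0)` (positive `α₀, γ₀`, `ξ ≠ 0`). [cite: Balaban1987RG1, (1.14) p.262] -/
theorem condIII_one_zero (X : Region P i) {c : StepConsts} (hξ : c.ξ ≠ 0) {α₀ γ₀ : ℝ} (h₀ : 0 < α₀) (hγ : 0 < γ₀) :
    CondIII X c α₀ γ₀ (1 : PBond P i → 𝔸ˣ) (fun _ => 0) :=
  ⟨fun p _ => plaq_one_lt p h₀ hξ, fun b _ => by simpa using hγ⟩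

/-- **Non-vacuity of (i)–(iii)**: for positive radii `α₀, α₁, γ₀`, `O(1)LMB > 0` and `ξ ≠ 0`, the unit pair `(𝐔, 𝐉) = (1, 0)`
satisfies the conditions (i)–(iii) on every frame (factorisation `U = 1`, `A′ = 0`; every printed strict bound holds with left
side `0`). [cite: Balaban1987RG1, (1.11)-(1.14) p.262] -/
theorem satisfiesI_III_unitPair (F : Frame P i 𝔸) {c : StepConsts} (hξ : c.ξ ≠ 0) (hc : 0 < c.cB) {α₀ α₁ γ₀ : ℝ}
    (h₀ : 0 < α₀) (h₁ : 0 < α₁) (hγ : 0 < γ₀) : SatisfiesI_III 𝓜 F c α₀ α₁ γ₀ unitPair :=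
  ⟨fun _ _ => 𝓜.Gc.one_mem, fun _ _ => 𝓜.gc.zero_mem, 1, fun _ => 0, factors_one c, condI_one F hξ hc h₀,
    condII_zero F.X c h₁ 1, condIII_one_zero F.X hξ h₀ hγ⟩

/-- The unit pair lies in `U^c_j(X, α₀, α₁, γ₀)` (positive radii, `O(1)LMB > 0`, `ξ, L ≠ 0`) AS SOON AS the (iv)-data send the unit
configuration to the unit / zero configurations (`U_n(M˙(1)) = 1`, `J_n(M˙(1)) = 0` — in print a property of the constructions of
[14, 15]; here, where those constructions are data, a hypothesis). [cite: Balaban1987RG1, (1.15)-(1.16) p.262] -/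
theorem unitPair_mem_space (F : Frame P i 𝔸) {c : StepConsts} (hξ : c.ξ ≠ 0) (hL : c.L ≠ 0) (hc : 0 < c.cB)
    {α₀ α₁ γ₀ : ℝ} (h₀ : 0 < α₀) (h₁ : 0 < α₁) (hγ : 0 < γ₀) (hUn : ∀ n, F.bg.Un n 1 = 1)
    (hJn : ∀ n b, F.bg.Jn n 1 b = 0) :
    (unitPair : FieldPair P i 𝔸ˣ 𝔸) ∈ space 𝓜 F c α₀ α₁ γ₀ := by
  have hIV : CondIV F.bg F.X₂ c α₀ (1 : PBond P i → 𝔸ˣ) := by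
    refine ⟨fun n _ _ p _ => ?_, fun n _ _ b _ => ?_⟩
    · rw [hUn]
      exact plaq_one_lt p h₀ hξ
    · rw [hJn, norm_zero]
      exact mul_pos h₀ (by positivity)
  exact mem_space_of_satisfies ⟨fun _ _ => 𝓜.Gc.one_mem, fun _ _ => 𝓜.gc.zero_mem, 1, fun _ => 0, factors_one c,
    condI_one F hξ hc h₀, condII_zero F.X c h₁ 1, condIII_one_zero F.X hξ h₀ hγ, hIV, hIV⟩

end

end Literature.MathematicalPhysics.QuantumFieldTheory.Balaban1983to89.B12RegularSpaces111Mono
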